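/-
Copyright (c) 2026 the pub-hodgecm-mathlib formalisation cell (harness21).  Prover seat hodgecm-mathlib-K2Liu-p10 (g0), Track B «K2-LIT»,
#184♮ = hLiu418 = `stmt-HodgeConjecture-24832`; LEAD F0P6-plan (g11) RE-DEAL 2026-09-04T05:43:59Z «(D-arch) → K2Liu-p10», box K2E5-r01 (g6) GO 05:58:26Z:
#33b (D-arch) — THE ARCHIMEDEAN SECTION PACKAGE `(hArch)` of the closer `siegelBigCellSection_of_localPackages` (K2Liu-p11 (g0)), in the frame
`G_∞ = U(V)(L⁺ ⊗ ℝ) = arch N (diag dV)` with `ι_∞(·, 1)` spelled `a ↦ archPart (iotaLeft (archToAdelic a))`.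
-/
import Summits.HodgeConjecture.HodgeConjecture.Theorems.K2LiuSiegelMainOrbitOpenEmbeddingArch     -- ★ (C1)–(C4): the archimedean chart
import Summits.HodgeConjecture.HodgeConjecture.Theorems.K2LiuSiegelMainOrbitSectionOfChart       -- ★ (D-arch-1): section from a chart, bump
import Summits.HodgeConjecture.HodgeConjecture.Theorems.K2LiuSiegelWeilSectionContinuous        -- ★ `continuous_siegelDeltaCharacter_subtype` (+ `siegelDelta`, `siegelDeltaCharacter`)
import Literature.NumberTheory.K2Lit.LocalDoublingEmbedding                                     -- ★ `iotaLeft`, `coe_iotaV`, `iotaMatrix_map`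
import Literature.NumberTheory.Automorphic.UnitaryGroupArchTopology                             -- ★ instances `T2Space ∕ LocallyCompactSpace (arch …)`
import Literature.NumberTheory.Automorphic.UnitaryGroupLevelTransport                           -- ★ `unitaryGroupOfForm_smul_of_isUnit`
import HarnessLib

/-!
# Crux `HLiu418`, road `K2_Liu`, socket #33b organ (D-arch): the ARCHIMEDEAN SECTION PACKAGE — good continuous Siegel sections at `∞`
# supported on the main orbit, with prescribed read-back along `ι_∞(·, 1)`

Cell `hodgecm-mathlib`, crux item hLiu418 = `stmt-HodgeConjecture-24832`; squad K2, LEAD F0P6-plan (g11∕g12), box K2E5-r01 (g6), consumer K2Liu-p11 (g0):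
the hypothesis `(hArch)` of `Theorems/K2LiuSiegelBigCellSectionOfLocal.lean :: siegelBigCellSection_of_localPackages (hArch) (hFin)` (memo
`K2/K2Liu-p11/g0/REPORT-33b-CLOSER.K2Liu-p11-g0.md`) is the conclusion of `archSectionPackage` below, BYTES AS TYPED THERE.  THEOREMS ONLY (no `def`, no
instance, no notation, no named-fact hypothesis, no `sorry`); lane `--supports stmt-HodgeConjecture-24832 --as helper` (count-neutral helper).

FRAME (the socket's, `M = 1`: `W` a line).  CM field `L`, `c` = complex conjugation, `e : Fin N × Fin 1 ≃ Fin n`, `V = diag dV`, `W = diag dW`, `J^𝔻 = hermD L e dV hdV dW hdW`;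
`R_∞ = L ⊗_ℚ ℝ = mixedSpace L`, `σ_∞ = conjMixed L⁺ L c`, `H_∞ = arch L⁺ L c (n+n) J^𝔻`, `G_∞ = arch L⁺ L c N (diag dV) = U(V)(L⁺ ⊗ ℝ)`,
`𝕁_∞ = reindex e e (archFormOf L N (diag dV) ⊗ₖ archFormOf L 1 (diag dW))` (file (C)'s pair form), `P_{Δ,∞} = (siegelDelta …).comap (archToAdelic …) ≤ H_∞`
(`↔ IsSiegelM`, ★ (C5)), `δ_∞ = siegelDeltaCharacter χ s₀ ∘ archToAdelic`, and `ι_∞(a, 1) := archPart (iotaLeft (archToAdelic a))` (all ★ maps; no new definition).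
* §1 RANK-ONE TRANSPORT: `reindex e e (A ⊗ₖ B) = reindex e′ e′ (B₀₀ • A)` for `1 × 1` blocks `B` (`e′ = (prodUnique)⁻¹ ≫ e`), hence `𝕁_∞ = reindex e′ e′ (w • (V ⊗ 1))`
  with the unit scalar `w = dW 0 ⊗ 1`, and **`exists_homeomorph_archRankOne`**: `κ : G_∞ ≃ₜ U(σ_∞, 𝕁_∞)`, `↑↑(κ a) = reindex e e (↑↑a ⊗ₖ 1)` (★ `unitaryGroupOfForm_smul_of_isUnit`);
* §2 **`coe_archPart_iotaLeft_archToAdelic`**: the matrix of `ι_∞(a, 1)` is `reindex e₂ e₂ (fromBlocks (reindex e e (↑↑a ⊗ₖ 1)) 0 0 1)` (★ `coe_iotaV`, `iotaMatrix_map`,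
  `map_fst_ofInfinite`; any `M`) — i.e. file (C)'s pinning hypothesis `hj` at `x = κ a`;
* §3 the chart in the `G_∞`-frame: **`isOpenEmbedding_siegel_mul_iotaInf`** and **`isClosed_siegel_mul_iotaInf_image_of_isCompact`** — ★ (C1)∕(C4) composed with the
  homeomorphisms `κ` and `P_{Δ,∞} ≃ₜ {IsSiegelM}` (★ (C5));
* §4 **`archSectionPackage`** = `(hArch)`: for every open `U_∞ ∋ 1` of `G_∞`, a continuous bump `g_∞ ≥ 0` with compact support in `U_∞`, `g_∞(1) > 0` (★ (D-arch-1)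
  `exists_continuous_hasCompactSupport_pos`; `arch` is locally compact Hausdorff by ★ `UnitaryGroupArchTopology`) and the continuous `δ_∞`-section `φ_∞ = δ_∞ ⊗ g_∞`
  on the main orbit (★ (D-arch-1) `exists_section_of_isOpenEmbedding`), reading back `φ_∞(ι_∞(a,1)) = g_∞(a)`.
[GelbartPiatetskishapiroRallis1987, Part A §1] [Liu2011, §2C p. 863] [HarrisKudlaSweet1996, §1 (1.9)–(1.12)] [BorelJacquet1979, §4.1] [Tan1999, §1].
HONEST LABEL.  Count-neutral helper; `HC_CM` is proved only modulo the 7 printed citations (2 remaining named inputs: hLiu418 = `stmt-HodgeConjecture-24832`,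
h413 = `stmt-HodgeConjecture-24833`) until rung 0 closes.
-/

set_option autoImplicit false
set_option linter.dupNamespace false -- the mandated namespace repeats `HodgeConjecture.HodgeConjecture`

noncomputable section

namespace Summit.HodgeConjecture.HodgeConjecture.Cruxes.HLiu418.K2LiuSiegelMainOrbitArchSection

open Matrix Topology Set Filter Function
open scoped Pointwise Kronecker
open NumberField NumberField.mixedEmbedding IsDedekindDomain
open Literature.NumberTheory.Automorphic Literature.NumberTheory.Automorphic.UnitaryGroup Literature.NumberTheory.GaloisRepresentations
open Literature.NumberTheory.GelbartRogawski1991 Literature.NumberTheory.GelbartRogawski1991.GRConstruction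
open Literature.NumberTheory.GelbartRogawski1991.UnitaryDualPair
open Literature.NumberTheory.K2Lit.SiegelDoubled
open Summit.HodgeConjecture.HodgeConjecture.Cruxes.HLiu418.K2LiuSiegelMainOrbitOpenEmbeddingGeneric
open Summit.HodgeConjecture.HodgeConjecture.Cruxes.HLiu418.K2LiuSiegelMainOrbitOpenEmbeddingArchPrelims
open Summit.HodgeConjecture.HodgeConjecture.Cruxes.HLiu418.K2LiuSiegelMainOrbitOpenEmbeddingArch
open Summit.HodgeConjecture.HodgeConjecture.Cruxes.HLiu418.K2LiuSiegelMainOrbitSectionOfChart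
open Summit.HodgeConjecture.HodgeConjecture.Cruxes.HLiu418.K2LiuSiegelWeilSectionContinuous

/-! ## §1 Rank-one transport: `G_∞ = U(V)(L⁺ ⊗ ℝ) ≃ₜ U(σ_∞, 𝕁_∞)` -/

section RankOne

/-- `reindex f (reindex f⁻¹ h) = h` in `GL`. [folklore] -/
theorem reindexGL_apply_symm_apply {R : Type*} [CommRing R] {m k : Type*} [Fintype m] [DecidableEq m] [Fintype k] [DecidableEq k]
    (f : m ≃ k) (h : GL k R) : UnitaryGroup.reindexGL f (UnitaryGroup.reindexGL f.symm h) = h :=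
  Units.ext (by
    simp only [UnitaryGroup.coe_reindexGL, Matrix.reindex_apply, Equiv.symm_symm, Matrix.submatrix_submatrix, Equiv.self_comp_symm,
      Matrix.submatrix_id_id])

/-- `reindex f⁻¹ (reindex f g) = g` in `GL`. [folklore] -/
theorem reindexGL_symm_apply_apply {R : Type*} [CommRing R] {m k : Type*} [Fintype m] [DecidableEq m] [Fintype k] [DecidableEq k]
    (f : m ≃ k) (g : GL m R) : UnitaryGroup.reindexGL f.symm (UnitaryGroup.reindexGL f g) = g :=
  Units.ext (by
    simp only [UnitaryGroup.coe_reindexGL, Matrix.reindex_apply, Equiv.symm_symm, Matrix.submatrix_submatrix, Equiv.symm_comp_self,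
      Matrix.submatrix_id_id])

/-- **`reindex e e (A ⊗ₖ B) = reindex e′ e′ (B₀₀ • A)`** for a `1 × 1` block `B`, `e′ = (prodUnique)⁻¹ ≫ e : Fin N ≃ Fin n`. [folklore] -/
theorem reindex_kronecker_fin_one {R : Type*} [CommSemiring R] {N n : ℕ} (e : Fin N × Fin 1 ≃ Fin n)
    (A : Matrix (Fin N) (Fin N) R) (B : Matrix (Fin 1) (Fin 1) R) :
    Matrix.reindex e e (A ⊗ₖ B) =
      Matrix.reindex ((Equiv.prodUnique (Fin N) (Fin 1)).symm.trans e) ((Equiv.prodUnique (Fin N) (Fin 1)).symm.trans e) (B 0 0 • A) := by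
  ext i j
  simp only [Matrix.reindex_apply, Matrix.submatrix_apply, Matrix.kroneckerMap_apply, Matrix.smul_apply, smul_eq_mul,
    Equiv.symm_trans_apply, Equiv.symm_symm, Equiv.prodUnique_apply]
  rw [Fin.fin_one_eq_zero (e.symm i).2, Fin.fin_one_eq_zero (e.symm j).2, mul_comm]

variable (L : Type) [Field L] [NumberField L] [IsCMField L]
variable {N n : ℕ} (e : Fin N × Fin 1 ≃ Fin n)
  (dV : Fin N → L) (hdV : ∀ i, IsCMField.complexConj L (dV i) = dV i)
  (dW : Fin 1 → L) (hdW : ∀ i, IsCMField.complexConj L (dW i) = dW i)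

omit [NumberField L] [IsCMField L] in
/-- **`𝕁_∞ = reindex e′ e′ (w • V_∞)`**, `w = dW 0 ⊗ 1`: the rank-one pair form is the `V`-form rescaled by the line's Gram scalar. [cite: HarrisKudlaSweet1996, §1 (1.9)] -/
theorem pairFormArch_rankOne :
    Matrix.reindex e e (archFormOf L N (Matrix.diagonal dV) ⊗ₖ archFormOf L 1 (Matrix.diagonal dW)) =
      Matrix.reindex ((Equiv.prodUnique (Fin N) (Fin 1)).symm.trans e) ((Equiv.prodUnique (Fin N) (Fin 1)).symm.trans e)
        (mixedEmbedding L (dW 0) • archFormOf L N (Matrix.diagonal dV)) := by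
  simp only [reindex_kronecker_fin_one, archFormOf, Matrix.map_apply, Matrix.diagonal_apply_eq]

/-- `reindex e′ g ∈ U(σ_∞, 𝕁_∞) ↔ g ∈ G_∞ = U(V)(L⁺ ⊗ ℝ)` (`dW 0 ≠ 0`; ★ `unitaryGroupOfForm_smul_of_isUnit`). [cite: HarrisKudlaSweet1996, §1 (1.9)] -/
theorem reindexGL_mem_pairU_iff (hdW0 : ∀ i, dW i ≠ 0) (g : GL (Fin N) (mixedSpace L)) :
    UnitaryGroup.reindexGL ((Equiv.prodUnique (Fin N) (Fin 1)).symm.trans e) g ∈ unitaryGroupOfForm (conjMixed (Fp L) L (IsCMField.complexConj L))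
        (Matrix.reindex e e (archFormOf L N (Matrix.diagonal dV) ⊗ₖ archFormOf L 1 (Matrix.diagonal dW))) ↔
      g ∈ arch (Fp L) L (IsCMField.complexConj L) N (Matrix.diagonal dV) := by
  rw [pairFormArch_rankOne, UnitaryGroup.reindexGL_mem_iff,
    unitaryGroupOfForm_smul_of_isUnit _ ((isUnit_iff_ne_zero.2 (hdW0 0)).map (mixedEmbedding L))]
  rfl

/-- `reindex e′⁻¹ y ∈ G_∞ ↔ y ∈ U(σ_∞, 𝕁_∞)`. [cite: HarrisKudlaSweet1996, §1 (1.9)] -/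
theorem reindexGL_symm_mem_arch_iff (hdW0 : ∀ i, dW i ≠ 0) (y : GL (Fin n) (mixedSpace L)) :
    UnitaryGroup.reindexGL ((Equiv.prodUnique (Fin N) (Fin 1)).symm.trans e).symm y ∈ arch (Fp L) L (IsCMField.complexConj L) N (Matrix.diagonal dV) ↔
      y ∈ unitaryGroupOfForm (conjMixed (Fp L) L (IsCMField.complexConj L))
        (Matrix.reindex e e (archFormOf L N (Matrix.diagonal dV) ⊗ₖ archFormOf L 1 (Matrix.diagonal dW))) := by
  rw [← reindexGL_mem_pairU_iff L e dV dW hdW0, reindexGL_apply_symm_apply]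

/-- **`κ : G_∞ = U(V)(L⁺ ⊗ ℝ) ≃ₜ U(σ_∞, 𝕁_∞)`** — the rank-one transport `a ↦ reindex e′ a`, a homeomorphism with `↑↑(κ a) = reindex e e (↑↑a ⊗ₖ 1)` (the matrix of
`a ⊗ 1` in the frame `e`). [cite: HarrisKudlaSweet1996, §1 (1.9)–(1.11)] -/
theorem exists_homeomorph_archRankOne (hdW0 : ∀ i, dW i ≠ 0) :
    ∃ κ : arch (Fp L) L (IsCMField.complexConj L) N (Matrix.diagonal dV) ≃ₜ
        unitaryGroupOfForm (conjMixed (Fp L) L (IsCMField.complexConj L))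
          (Matrix.reindex e e (archFormOf L N (Matrix.diagonal dV) ⊗ₖ archFormOf L 1 (Matrix.diagonal dW))),
      (∀ a, ((κ a : unitaryGroupOfForm (conjMixed (Fp L) L (IsCMField.complexConj L))
          (Matrix.reindex e e (archFormOf L N (Matrix.diagonal dV) ⊗ₖ archFormOf L 1 (Matrix.diagonal dW)))) : GL (Fin n) (mixedSpace L)) =
          UnitaryGroup.reindexGL ((Equiv.prodUnique (Fin N) (Fin 1)).symm.trans e) (a : GL (Fin N) (mixedSpace L))) ∧
      (∀ a, (((κ a : unitaryGroupOfForm (conjMixed (Fp L) L (IsCMField.complexConj L))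
          (Matrix.reindex e e (archFormOf L N (Matrix.diagonal dV) ⊗ₖ archFormOf L 1 (Matrix.diagonal dW)))) : GL (Fin n) (mixedSpace L)) :
            Matrix (Fin n) (Fin n) (mixedSpace L)) =
          Matrix.reindex e e (((a : GL (Fin N) (mixedSpace L)) : Matrix (Fin N) (Fin N) (mixedSpace L)) ⊗ₖ (1 : Matrix (Fin 1) (Fin 1) (mixedSpace L)))) := by
  refine ⟨{ toFun := fun a => ⟨UnitaryGroup.reindexGL ((Equiv.prodUnique (Fin N) (Fin 1)).symm.trans e) (a : GL (Fin N) (mixedSpace L)),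
              (reindexGL_mem_pairU_iff L e dV dW hdW0 _).2 a.2⟩
            invFun := fun y => ⟨UnitaryGroup.reindexGL ((Equiv.prodUnique (Fin N) (Fin 1)).symm.trans e).symm (y : GL (Fin n) (mixedSpace L)),
              (reindexGL_symm_mem_arch_iff L e dV dW hdW0 _).2 y.2⟩
            left_inv := fun a => by
              apply Subtype.ext
              exact reindexGL_symm_apply_apply _ (a : GL (Fin N) (mixedSpace L))
            right_inv := fun y => by
              apply Subtype.ext
              exact reindexGL_apply_symm_apply _ (y : GL (Fin n) (mixedSpace L))
            continuous_toFun := continuous_induced_rng.2 ((UnitaryGroup.continuous_reindexGL _).comp continuous_subtype_val)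
            continuous_invFun := continuous_induced_rng.2 ((UnitaryGroup.continuous_reindexGL _).comp continuous_subtype_val) },
    fun _ => rfl, fun a => ?_⟩
  change ((UnitaryGroup.reindexGL ((Equiv.prodUnique (Fin N) (Fin 1)).symm.trans e) (a : GL (Fin N) (mixedSpace L)) : GL (Fin n) (mixedSpace L)) :
      Matrix (Fin n) (Fin n) (mixedSpace L)) = _
  rw [UnitaryGroup.coe_reindexGL, reindex_kronecker_fin_one, Matrix.one_apply_eq, one_smul]

end RankOne

/-! ## §2 The matrix of `ι_∞(a, 1) = archPart (iotaLeft (archToAdelic a))` -/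

section IotaInf

variable (L : Type) [Field L] [NumberField L] [IsCMField L]
variable {N M n : ℕ} (e : Fin N × Fin M ≃ Fin n)
  (dV : Fin N → L) (hdV : ∀ i, IsCMField.complexConj L (dV i) = dV i)
  (dW : Fin M → L) (hdW : ∀ i, IsCMField.complexConj L (dW i) = dW i)

/-- **the matrix of `ι_∞(a, 1) := archPart (iotaLeft (archToAdelic a))`** is `reindex e₂ e₂ (fromBlocks (reindex e e (a ⊗ 1)) 0 0 1)` — file (C)'s pinning
hypothesis `hj` in the frame `e`. [cite: HarrisKudlaSweet1996, §1 (1.11)] [cite: BorelJacquet1979, §4.1] -/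
theorem coe_archPart_iotaLeft_archToAdelic (a : arch (Fp L) L (IsCMField.complexConj L) N (Matrix.diagonal dV)) :
    (((archPart (Fp L) L (IsCMField.complexConj L) (n + n) (hermD L e dV hdV dW hdW)
          (iotaLeft L e dV hdV dW hdW (archToAdelic (Fp L) L (IsCMField.complexConj L) N (Matrix.diagonal dV) a)) :
          arch (Fp L) L (IsCMField.complexConj L) (n + n) (hermD L e dV hdV dW hdW)) : GL (Fin (n + n)) (mixedSpace L)) :
        Matrix (Fin (n + n)) (Fin (n + n)) (mixedSpace L)) =
      Matrix.reindex (e₂ (n := n)) (e₂ (n := n))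
        (fromBlocks (Matrix.reindex e e (((a : GL (Fin N) (mixedSpace L)) : Matrix (Fin N) (Fin N) (mixedSpace L)) ⊗ₖ
          (1 : Matrix (Fin M) (Fin M) (mixedSpace L)))) 0 0 1) := by
  -- the matrix of `toMixed X` is `X` read through the archimedean projection `𝔸_L → L ⊗ ℝ`
  have hmix : ∀ X : GL (Fin (n + n)) (AdeleRing (𝓞 L) L),
      ((GLn.toMixed (n + n) L X : GL (Fin (n + n)) (mixedSpace L)) : Matrix (Fin (n + n)) (Fin (n + n)) (mixedSpace L)) =
        ((X : GL (Fin (n + n)) (AdeleRing (𝓞 L) L)) : Matrix (Fin (n + n)) (Fin (n + n)) (AdeleRing (𝓞 L) L)).map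
          ((InfiniteAdeleRing.ringEquiv_mixedSpace L).toRingHom.comp (adeleFst L)) := fun X => by
    rw [RingHom.coe_comp, ← Matrix.map_map]
    rfl
  -- the archimedean projection of the matrix of `archToAdelic a = (a, 1)` is the matrix of `a`
  have harch : (adelicVal (Fp L) L (IsCMField.complexConj L) N (Matrix.diagonal dV)
        (archToAdelic (Fp L) L (IsCMField.complexConj L) N (Matrix.diagonal dV) a) : Matrix (Fin N) (Fin N) (AdeleRing (𝓞 L) L)).map
        ((InfiniteAdeleRing.ringEquiv_mixedSpace L).toRingHom.comp (adeleFst L)) =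
      ((a : GL (Fin N) (mixedSpace L)) : Matrix (Fin N) (Fin N) (mixedSpace L)) := by
    rw [adelicVal_archToAdelic, RingHom.coe_comp, ← Matrix.map_map]
    rw [map_fst_ofInfinite, Matrix.map_map]
    have hid : (⇑(InfiniteAdeleRing.ringEquiv_mixedSpace L).toRingHom ∘ ⇑(InfiniteAdeleRing.ringEquiv_mixedSpace L).symm.toRingHom :
        mixedSpace L → mixedSpace L) = id := funext fun x => (InfiniteAdeleRing.ringEquiv_mixedSpace L).apply_symm_apply x
    rw [hid, Matrix.map_id]
  -- the second block `1 ⊗ 1` reads `1`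
  have hone : Matrix.reindex e e ((adelicVal (Fp L) L (IsCMField.complexConj L) N (Matrix.diagonal dV)
        (1 : adelic (Fp L) L (IsCMField.complexConj L) N (Matrix.diagonal dV)) : Matrix (Fin N) (Fin N) (AdeleRing (𝓞 L) L)).map
        ((InfiniteAdeleRing.ringEquiv_mixedSpace L).toRingHom.comp (adeleFst L)) ⊗ₖ (1 : Matrix (Fin M) (Fin M) (mixedSpace L))) = 1 := by
    rw [adelicVal_apply, OneMemClass.coe_one, Units.val_one, Matrix.map_one _ (map_zero _) (map_one _), Matrix.one_kronecker_one, Matrix.reindex_apply,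
      Matrix.submatrix_one_equiv]
  rw [coe_archPart, hmix, iotaLeft_apply, adelicVal_apply, coe_iotaV, iotaMatrix_map]
  change Matrix.reindex (e₂ (n := n)) (e₂ (n := n)) (fromBlocks
      (Matrix.reindex e e ((adelicVal (Fp L) L (IsCMField.complexConj L) N (Matrix.diagonal dV)
        (archToAdelic (Fp L) L (IsCMField.complexConj L) N (Matrix.diagonal dV) a) : Matrix (Fin N) (Fin N) (AdeleRing (𝓞 L) L)).map
        ((InfiniteAdeleRing.ringEquiv_mixedSpace L).toRingHom.comp (adeleFst L)) ⊗ₖ (1 : Matrix (Fin M) (Fin M) (mixedSpace L)))) 0 0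
      (Matrix.reindex e e ((adelicVal (Fp L) L (IsCMField.complexConj L) N (Matrix.diagonal dV)
        (1 : adelic (Fp L) L (IsCMField.complexConj L) N (Matrix.diagonal dV)) : Matrix (Fin N) (Fin N) (AdeleRing (𝓞 L) L)).map
        ((InfiniteAdeleRing.ringEquiv_mixedSpace L).toRingHom.comp (adeleFst L)) ⊗ₖ (1 : Matrix (Fin M) (Fin M) (mixedSpace L))))) = _
  rw [harch, hone]

end IotaInf

/-! ## §3 The chart in the frame `G_∞ = U(V)(L⁺ ⊗ ℝ)`, `P_{Δ,∞} = siegelDelta.comap archToAdelic` -/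

section ArchFrame

variable (L : Type) [Field L] [NumberField L] [IsCMField L]

section AnyRank

variable {N M n : ℕ} (e : Fin N × Fin M ≃ Fin n)
  (dV : Fin N → L) (hdV : ∀ i, IsCMField.complexConj L (dV i) = dV i)
  (dW : Fin M → L) (hdW : ∀ i, IsCMField.complexConj L (dW i) = dW i)

/-- **`P_{Δ,∞} := (siegelDelta).comap archToAdelic` has carrier `{p | IsSiegelM ↑↑p}`** (★ (C5) `isSiegelDelta_archToAdelic_iff`).
[cite: BorelJacquet1979, §4.1] [cite: GelbartPiatetskishapiroRallis1987, Part A §1] -/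
theorem coe_comap_siegelDelta_archToAdelic :
    (((siegelDelta L e dV hdV dW hdW).comap (archToAdelic (Fp L) L (IsCMField.complexConj L) (n + n) (hermD L e dV hdV dW hdW)) :
        Subgroup (arch (Fp L) L (IsCMField.complexConj L) (n + n) (hermD L e dV hdV dW hdW))) :
        Set (arch (Fp L) L (IsCMField.complexConj L) (n + n) (hermD L e dV hdV dW hdW))) =
      {p : arch (Fp L) L (IsCMField.complexConj L) (n + n) (hermD L e dV hdV dW hdW) |
        IsSiegelM ((p : GL (Fin (n + n)) (mixedSpace L)) : Matrix (Fin (n + n)) (Fin (n + n)) (mixedSpace L))} := by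
  ext p
  exact isSiegelDelta_archToAdelic_iff L e dV hdV dW hdW p

end AnyRank

variable {N n : ℕ} (e : Fin N × Fin 1 ≃ Fin n)
  (dV : Fin N → L) (hdV : ∀ i, IsCMField.complexConj L (dV i) = dV i)
  (dW : Fin 1 → L) (hdW : ∀ i, IsCMField.complexConj L (dW i) = dW i)

/-- **TRANSPORT TO THE `G_∞`-FRAME.**  The chart `(p, a) ↦ p · ι_∞(a, 1)` on `P_{Δ,∞} × G_∞` FACTORS through file (C)'s chart for the pinned embedding
`j := ι_∞(·, 1) ∘ κ⁻¹` on `{IsSiegelM} × U(σ_∞, 𝕁_∞)` via the homeomorphism `(P_{Δ,∞} ≃ₜ {IsSiegelM}) × κ`.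
[cite: HarrisKudlaSweet1996, §1 (1.9)–(1.11)] [cite: GelbartPiatetskishapiroRallis1987, Part A §1] -/
theorem exists_transport_archFrame (hdW0 : ∀ i, dW i ≠ 0) :
    ∃ (κ : arch (Fp L) L (IsCMField.complexConj L) N (Matrix.diagonal dV) ≃ₜ
          unitaryGroupOfForm (conjMixed (Fp L) L (IsCMField.complexConj L))
            (Matrix.reindex e e (archFormOf L N (Matrix.diagonal dV) ⊗ₖ archFormOf L 1 (Matrix.diagonal dW))))
      (eP : ((siegelDelta L e dV hdV dW hdW).comap (archToAdelic (Fp L) L (IsCMField.complexConj L) (n + n) (hermD L e dV hdV dW hdW)) :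
          Subgroup (arch (Fp L) L (IsCMField.complexConj L) (n + n) (hermD L e dV hdV dW hdW))) ≃ₜ
        {p : arch (Fp L) L (IsCMField.complexConj L) (n + n) (hermD L e dV hdV dW hdW) //
          IsSiegelM ((p : GL (Fin (n + n)) (mixedSpace L)) : Matrix (Fin (n + n)) (Fin (n + n)) (mixedSpace L))}),
      (∀ y, (((archPart (Fp L) L (IsCMField.complexConj L) (n + n) (hermD L e dV hdV dW hdW)
          (iotaLeft L e dV hdV dW hdW (archToAdelic (Fp L) L (IsCMField.complexConj L) N (Matrix.diagonal dV) (κ.symm y))) :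
          arch (Fp L) L (IsCMField.complexConj L) (n + n) (hermD L e dV hdV dW hdW)) : GL (Fin (n + n)) (mixedSpace L)) :
            Matrix (Fin (n + n)) (Fin (n + n)) (mixedSpace L)) =
        Matrix.reindex (e₂ (n := n)) (e₂ (n := n)) (fromBlocks ((y : GL (Fin n) (mixedSpace L)) : Matrix (Fin n) (Fin n) (mixedSpace L)) 0 0 1)) ∧
      (fun px : ((siegelDelta L e dV hdV dW hdW).comap (archToAdelic (Fp L) L (IsCMField.complexConj L) (n + n) (hermD L e dV hdV dW hdW)) :
            Subgroup (arch (Fp L) L (IsCMField.complexConj L) (n + n) (hermD L e dV hdV dW hdW))) ×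
          arch (Fp L) L (IsCMField.complexConj L) N (Matrix.diagonal dV) =>
          (px.1 : arch (Fp L) L (IsCMField.complexConj L) (n + n) (hermD L e dV hdV dW hdW)) *
            archPart (Fp L) L (IsCMField.complexConj L) (n + n) (hermD L e dV hdV dW hdW)
              (iotaLeft L e dV hdV dW hdW (archToAdelic (Fp L) L (IsCMField.complexConj L) N (Matrix.diagonal dV) px.2))) =
        (fun qx : {p : arch (Fp L) L (IsCMField.complexConj L) (n + n) (hermD L e dV hdV dW hdW) //
              IsSiegelM ((p : GL (Fin (n + n)) (mixedSpace L)) : Matrix (Fin (n + n)) (Fin (n + n)) (mixedSpace L))} ×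
            unitaryGroupOfForm (conjMixed (Fp L) L (IsCMField.complexConj L))
              (Matrix.reindex e e (archFormOf L N (Matrix.diagonal dV) ⊗ₖ archFormOf L 1 (Matrix.diagonal dW))) =>
            (qx.1.1 : arch (Fp L) L (IsCMField.complexConj L) (n + n) (hermD L e dV hdV dW hdW)) *
              archPart (Fp L) L (IsCMField.complexConj L) (n + n) (hermD L e dV hdV dW hdW)
                (iotaLeft L e dV hdV dW hdW (archToAdelic (Fp L) L (IsCMField.complexConj L) N (Matrix.diagonal dV) (κ.symm qx.2)))) ∘
          ⇑(eP.prodCongr κ) := by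
  obtain ⟨κ, -, hκ⟩ := exists_homeomorph_archRankOne L e dV dW hdW0
  have hset := coe_comap_siegelDelta_archToAdelic L e dV hdV dW hdW
  let eP : ((siegelDelta L e dV hdV dW hdW).comap (archToAdelic (Fp L) L (IsCMField.complexConj L) (n + n) (hermD L e dV hdV dW hdW)) :
          Subgroup (arch (Fp L) L (IsCMField.complexConj L) (n + n) (hermD L e dV hdV dW hdW))) ≃ₜ
        {p : arch (Fp L) L (IsCMField.complexConj L) (n + n) (hermD L e dV hdV dW hdW) //
          IsSiegelM ((p : GL (Fin (n + n)) (mixedSpace L)) : Matrix (Fin (n + n)) (Fin (n + n)) (mixedSpace L))} :=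
    { toFun := fun p => ⟨p.1, (isSiegelDelta_archToAdelic_iff L e dV hdV dW hdW p.1).1
        ((mem_siegelDelta_iff L e dV hdV dW hdW _).1 (Subgroup.mem_comap.1 p.2))⟩
      invFun := fun q => ⟨q.1, Subgroup.mem_comap.2 ((mem_siegelDelta_iff L e dV hdV dW hdW _).2
        ((isSiegelDelta_archToAdelic_iff L e dV hdV dW hdW q.1).2 q.2))⟩
      left_inv := fun p => rfl
      right_inv := fun q => rfl
      continuous_toFun := continuous_induced_rng.2 continuous_subtype_val
      continuous_invFun := continuous_induced_rng.2 continuous_subtype_val }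
  refine ⟨κ, eP, fun y => ?_, funext fun px => ?_⟩
  · rw [coe_archPart_iotaLeft_archToAdelic, ← hκ, Homeomorph.apply_symm_apply]
  · simp only [Function.comp_apply, Homeomorph.coe_prodCongr, Prod.map_fst, Prod.map_snd, Homeomorph.symm_apply_apply]
    rfl

/-- **(C1 in the `G_∞`-frame) the chart `(p, a) ↦ p · ι_∞(a, 1) : P_{Δ,∞} × U(V)(L⁺ ⊗ ℝ) → H_∞` is an OPEN EMBEDDING.**
[cite: GelbartPiatetskishapiroRallis1987, Part A §1] [cite: Liu2021, §B.3 (B.5), Lem. B.11] [cite: HarrisKudlaSweet1996, §1 (1.11)] -/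
theorem isOpenEmbedding_siegel_mul_iotaInf (hdV0 : ∀ i, dV i ≠ 0) (hdW0 : ∀ i, dW i ≠ 0) :
    IsOpenEmbedding fun px : ((siegelDelta L e dV hdV dW hdW).comap (archToAdelic (Fp L) L (IsCMField.complexConj L) (n + n) (hermD L e dV hdV dW hdW)) :
          Subgroup (arch (Fp L) L (IsCMField.complexConj L) (n + n) (hermD L e dV hdV dW hdW))) ×
        arch (Fp L) L (IsCMField.complexConj L) N (Matrix.diagonal dV) =>
      (px.1 : arch (Fp L) L (IsCMField.complexConj L) (n + n) (hermD L e dV hdV dW hdW)) *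
        archPart (Fp L) L (IsCMField.complexConj L) (n + n) (hermD L e dV hdV dW hdW)
          (iotaLeft L e dV hdV dW hdW (archToAdelic (Fp L) L (IsCMField.complexConj L) N (Matrix.diagonal dV) px.2)) := by
  obtain ⟨κ, eP, hj, hfun⟩ := exists_transport_archFrame L e dV hdV dW hdW hdW0
  rw [hfun]
  exact (isOpenEmbedding_siegel_mul_iotaArch (isUnit_det_pairFormArch L e dV hdV dW hdW hdV0 hdW0) _ hj).comp (eP.prodCongr κ).isOpenEmbedding

/-- **(C4 = D1 in the `G_∞`-frame) `P_{Δ,∞} · ι_∞(C, 1)` is CLOSED in `H_∞` for `C ⊆ U(V)(L⁺ ⊗ ℝ)` compact.**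
[cite: GelbartPiatetskishapiroRallis1987, Part A §1 (`P\Ω ≅ G`)] -/
theorem isClosed_siegel_mul_iotaInf_image_of_isCompact (hdW0 : ∀ i, dW i ≠ 0)
    {C : Set (arch (Fp L) L (IsCMField.complexConj L) N (Matrix.diagonal dV))} (hC : IsCompact C) :
    IsClosed ((fun px : ((siegelDelta L e dV hdV dW hdW).comap (archToAdelic (Fp L) L (IsCMField.complexConj L) (n + n) (hermD L e dV hdV dW hdW)) :
          Subgroup (arch (Fp L) L (IsCMField.complexConj L) (n + n) (hermD L e dV hdV dW hdW))) ×
        arch (Fp L) L (IsCMField.complexConj L) N (Matrix.diagonal dV) =>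
      (px.1 : arch (Fp L) L (IsCMField.complexConj L) (n + n) (hermD L e dV hdV dW hdW)) *
        archPart (Fp L) L (IsCMField.complexConj L) (n + n) (hermD L e dV hdV dW hdW)
          (iotaLeft L e dV hdV dW hdW (archToAdelic (Fp L) L (IsCMField.complexConj L) N (Matrix.diagonal dV) px.2))) '' (Set.univ ×ˢ C)) := by
  obtain ⟨κ, eP, hj, hfun⟩ := exists_transport_archFrame L e dV hdV dW hdW hdW0
  have hΦ : ⇑(eP.prodCongr κ) '' (Set.univ ×ˢ C) = Set.univ ×ˢ (κ '' C) := by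
    ext qx
    constructor
    · rintro ⟨px, hpx, rfl⟩
      exact ⟨Set.mem_univ _, Set.mem_image_of_mem _ hpx.2⟩
    · rintro ⟨-, ⟨a, ha, hax⟩⟩
      exact ⟨(eP.symm qx.1, a), ⟨Set.mem_univ _, ha⟩, Prod.ext (eP.apply_symm_apply qx.1) hax⟩
  rw [hfun, Set.image_comp, hΦ]
  exact isClosed_siegel_mul_iotaArch_image_of_isCompact _ hj (hC.image κ.continuous)

/-! ## §4 The archimedean section package `(hArch)` -/

/-- **`(hArch)` — THE ARCHIMEDEAN SECTION PACKAGE of the #33b closer** (`siegelBigCellSection_of_localPackages (hArch) (hFin)`, K2Liu-p11 (g0)):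
for every open `U_∞ ∋ 1` of `G_∞ = U(V)(L⁺ ⊗ ℝ)` there are a CONTINUOUS `φ_∞ : H_∞ → ℂ` and a bump `g_∞ : G_∞ → ℝ` with
`φ_∞(p·u) = δ_{χ,s₀}(p)·φ_∞(u)` for `p ∈ P_{Δ,∞}` (`archToAdelic p ∈ P_Δ(𝔸)`), `φ_∞(ι_∞(a, 1)) = g_∞(a)`, `g_∞` continuous, compactly supported in `U_∞`,
`0 ≤ g_∞`, `g_∞(1) > 0` — `φ_∞ = δ_∞ ⊗ g_∞` on the main orbit (★ (D-arch-1) through (C1)∕(C4) in the `G_∞`-frame), `g_∞` a Urysohn bump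
(`arch` is locally compact Hausdorff, ★ `UnitaryGroupArchTopology`).
[cite: GelbartPiatetskishapiroRallis1987, Part A §1] [cite: Liu2011, §2C p. 863] [cite: Tan1999, §1] [cite: BorelJacquet1979, §4.1] -/
theorem archSectionPackage (hdV0 : ∀ i, dV i ≠ 0) (hdW0 : ∀ i, dW i ≠ 0) (χ : HeckeCharacter L) (s₀ : ℂ) :
    ∀ (Ui : Set (UnitaryGroup.arch (Fp L) L (IsCMField.complexConj L) N (Matrix.diagonal dV))), IsOpen Ui → 1 ∈ Ui →
      ∃ (φi : UnitaryGroup.arch (Fp L) L (IsCMField.complexConj L) (n + n) (hermD L e dV hdV dW hdW) → ℂ)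
        (gi : UnitaryGroup.arch (Fp L) L (IsCMField.complexConj L) N (Matrix.diagonal dV) → ℝ),
        (∀ p u, IsSiegelDelta L e dV hdV dW hdW (UnitaryGroup.archToAdelic (Fp L) L (IsCMField.complexConj L) (n + n) (hermD L e dV hdV dW hdW) p) →
            φi (p * u) = siegelDeltaCharacter L e dV hdV dW hdW χ s₀
              (UnitaryGroup.archToAdelic (Fp L) L (IsCMField.complexConj L) (n + n) (hermD L e dV hdV dW hdW) p) * φi u) ∧
        Continuous φi ∧
        (∀ a, φi (UnitaryGroup.archPart (Fp L) L (IsCMField.complexConj L) (n + n) (hermD L e dV hdV dW hdW)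
            (iotaLeft L e dV hdV dW hdW (UnitaryGroup.archToAdelic (Fp L) L (IsCMField.complexConj L) N (Matrix.diagonal dV) a))) = ((gi a : ℝ) : ℂ)) ∧
        Continuous gi ∧ HasCompactSupport gi ∧ 0 ≤ gi ∧ Function.support gi ⊆ Ui ∧ 0 < gi 1 := by
  intro Ui hUi h1
  obtain ⟨gi, hgc, hgK, hg0, hgU, hg1⟩ :=
    exists_continuous_hasCompactSupport_pos (1 : arch (Fp L) L (IsCMField.complexConj L) N (Matrix.diagonal dV)) hUi h1
  have hδc : Continuous fun p : ((siegelDelta L e dV hdV dW hdW).comap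
      (archToAdelic (Fp L) L (IsCMField.complexConj L) (n + n) (hermD L e dV hdV dW hdW)) :
        Subgroup (arch (Fp L) L (IsCMField.complexConj L) (n + n) (hermD L e dV hdV dW hdW))) =>
      siegelDeltaCharacter L e dV hdV dW hdW χ s₀
        (archToAdelic (Fp L) L (IsCMField.complexConj L) (n + n) (hermD L e dV hdV dW hdW) (p : arch (Fp L) L (IsCMField.complexConj L) (n + n) (hermD L e dV hdV dW hdW))) := by
    have hψ : Continuous fun p : ((siegelDelta L e dV hdV dW hdW).comap
        (archToAdelic (Fp L) L (IsCMField.complexConj L) (n + n) (hermD L e dV hdV dW hdW)) :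
          Subgroup (arch (Fp L) L (IsCMField.complexConj L) (n + n) (hermD L e dV hdV dW hdW))) =>
        (⟨archToAdelic (Fp L) L (IsCMField.complexConj L) (n + n) (hermD L e dV hdV dW hdW) (p : arch (Fp L) L (IsCMField.complexConj L) (n + n) (hermD L e dV hdV dW hdW)),
          Subgroup.mem_comap.1 p.2⟩ : siegelDelta L e dV hdV dW hdW) :=
      -- continuity of `archToAdelic = (·, 1)` in the `↥HA` currency (★ `GLn.continuous_ofInfinite`; avoids the datum's `Adelic` topology instance)
      continuous_induced_rng.2 (Continuous.subtype_mk
        ((GLn.continuous_ofInfinite (n + n) L).comp (continuous_subtype_val.comp continuous_subtype_val)) _)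
    exact ((continuous_siegelDeltaCharacter_subtype L e dV hdV dW hdW χ s₀).comp hψ).congr fun _ => rfl
  obtain ⟨φ, hφc, hφP, hφj, -⟩ := exists_section_of_isOpenEmbedding
    ((siegelDelta L e dV hdV dW hdW).comap (archToAdelic (Fp L) L (IsCMField.complexConj L) (n + n) (hermD L e dV hdV dW hdW)))
    (fun a : arch (Fp L) L (IsCMField.complexConj L) N (Matrix.diagonal dV) =>
      archPart (Fp L) L (IsCMField.complexConj L) (n + n) (hermD L e dV hdV dW hdW)
        (iotaLeft L e dV hdV dW hdW (archToAdelic (Fp L) L (IsCMField.complexConj L) N (Matrix.diagonal dV) a)))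
    (isOpenEmbedding_siegel_mul_iotaInf L e dV hdV dW hdW hdV0 hdW0)
    (fun C hC => isClosed_siegel_mul_iotaInf_image_of_isCompact L e dV hdV dW hdW hdW0 hC)
    (fun h : arch (Fp L) L (IsCMField.complexConj L) (n + n) (hermD L e dV hdV dW hdW) =>
      siegelDeltaCharacter L e dV hdV dW hdW χ s₀ (archToAdelic (Fp L) L (IsCMField.complexConj L) (n + n) (hermD L e dV hdV dW hdW) h))
    (fun p hp q hq => by
      simp only [map_mul]
      exact siegelDeltaCharacter_mul L e dV hdV dW hdW χ s₀ ((mem_siegelDelta_iff L e dV hdV dW hdW _).1 (Subgroup.mem_comap.1 hp))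
        ((mem_siegelDelta_iff L e dV hdV dW hdW _).1 (Subgroup.mem_comap.1 hq)))
    (by simp only [map_one]; exact siegelDeltaCharacter_one L e dV hdV dW hdW χ s₀)
    hδc (fun a => ((gi a : ℝ) : ℂ)) (Complex.continuous_ofReal.comp hgc) (hgK.comp_left Complex.ofReal_zero)
  exact ⟨φ, gi, fun p u hp => hφP p (Subgroup.mem_comap.2 ((mem_siegelDelta_iff L e dV hdV dW hdW _).2 hp)) u, hφc, hφj,
    hgc, hgK, hg0, hgU, hg1⟩

end ArchFrame


end Summit.HodgeConjecture.HodgeConjecture.Cruxes.HLiu418.K2LiuSiegelMainOrbitArchSection
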